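import Summits.QuantumFields.YangMills.Theorems.VirialFluxGapSharpTwistedLaplaceQuantitativeLaplaceGauss
import HarnessLib

/-!
# Determinant comparison for coercive symmetric operators: monotonicity on the positive cone and
# `|log det A − log det B| ≤ 2m·δ/λ` under a quadratic-form perturbation `|⟪Ay,y⟫ − ⟪By,y⟫| ≤ δ‖y‖²`
# (free-hands support of ⟨stmt-QuantumFields-24197⟩ `SwapVirialDeficit.SwapGluedStiffness`; generic linear algebra, companion of
# ✓`VirialFluxGapSharpTwistedLaplaceDetBounds` and of the fibred Laplace layer `SwapVirialDeficitQuantitativeLaplaceFibred`)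

For symmetric operators `A`, `B` on a finite-dimensional real inner-product space `V` of dimension `m`:
* ★ `det_le_det_of_inner_le` — MONOTONICITY of the determinant on the positive cone: `A` coercive and `⟪Ay,y⟫ ≤ ⟪By,y⟫` for all `y`
  ⟹ `det A ≤ det B`.  Proof WITHOUT min–max ∕ square roots: the anisotropic Gaussian integral ✓`integral_exp_neg_mul_half_inner`
  `∫ e^{−½⟪Ay,y⟫} = (2π)^{m/2}/√det A` is monotone in the quadratic form.
* ★★ `pow_mul_det_le_det_of_inner_sub_le` ∕ `det_le_pow_mul_det_of_inner_sub_le` — if `B` is `λ`-coercive and `|⟪Ay,y⟫ − ⟪By,y⟫| ≤ δ‖y‖²`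
  with `0 ≤ δ < λ`, then `(1 − δ/λ)^m·det B ≤ det A ≤ (1 + δ/λ)^m·det B` (monotonicity against the rescaled operators `(1 ∓ δ/λ)•B`).
* ★★ `abs_log_det_sub_log_det_le` — hence, for `δ ≤ λ/2`, `|log det A − log det B| ≤ 2m·δ/λ`.

WHY (the use; LEAD ym-line-sfw-p2 g96 memo2 §3, fcl-p3 g46 memo #28, this seat's memo on the fibred architecture).  In the window-uniform
(«`L ≤ β^a`») programme the `≍ 18L⁴` massive directions are integrated fibrewise over the valley of commuting leaders; the Gaussian main term of
the fibre over a leader configuration `ℓ` is `(2π/β)^{m/2}(det A(ℓ))^{−1/2}` (the one-loop weight).  The Hessian field `ℓ ↦ A(ℓ)` of the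
deficit is `poly(L)`-Lipschitz in the quadratic-form sense and `1/poly(L)`-coercive, so by ★★ the one-loop weight varies by the factor
`exp(±2m·δ/λ) = exp(±poly(L)·‖ℓ − ℓ*‖)` between `ℓ` and its valley projection `ℓ*` — negligible on the effective region `‖ℓ − ℓ*‖ ≲ β^{−1/4}`
of a deep window, with NO regularity of the effective potential along the valley required.  This file is that comparison in generic form.

HONEST FRAMING: linear algebra ∕ real analysis; width 0 by itself toward any lattice statement; ⟨24197⟩, ⟨24196⟩, ⟨24194⟩, ⟨24497⟩ and every
rung ∕ summit statement stay OPEN; own crux ⟨22884⟩ OPEN (blocked-on ⟨19935⟩); the Yang–Mills mass gap is NOT proved; no summit is proved by a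
line.  Width seat ym-line-sfw-p2-w2 g58 (cell ym-idea-1, free hands), `--supports stmt-QuantumFields-24197`.  THEOREMS ONLY (0 `def`,
0 `sorry`), standard axioms.

## References
* K. W. Breitung, *Asymptotic Approximations for Probability Integrals*, LNM 1592 (1994), Lemma 26 (2.102) p. 30 (the anisotropic
  Gaussian integral). [Breitung1994]
* R. A. Horn, C. R. Johnson, *Matrix Analysis* (2nd ed., CUP 2013), Cor. 7.7.4 (c) (`0 ≺ A ⪯ B ⟹ det A ≤ det B`) — here proved by
  Gaussian integrals instead of the Löwner-order calculus. [folklore]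
-/

set_option autoImplicit false

noncomputable section

open _root_.MeasureTheory _root_.Module
open scoped _root_.Real _root_.InnerProductSpace

namespace Summit.QuantumFields.YangMills.Theorems.QuantitativeLaplace

open Literature.Analysis.Asymptotics

variable {V : Type*} [NormedAddCommGroup V] [InnerProductSpace ℝ V] [FiniteDimensional ℝ V]
  [MeasurableSpace V] [BorelSpace V]

/-! ## §1 Monotonicity of the determinant on the positive cone -/

/-- ★ **`det` is monotone on the positive cone**: if `A`, `B` are symmetric, `A` is coercive (`λ‖y‖² ≤ ⟪Ay,y⟫`, `λ > 0`) and
`⟪Ay,y⟫ ≤ ⟪By,y⟫` for every `y`, then `det A ≤ det B`.  Proof by Gaussian integrals: `e^{−½⟪By,y⟫} ≤ e^{−½⟪Ay,y⟫}` pointwise, and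
`∫ e^{−½⟪Cy,y⟫} dy = (2π)^{m/2}/√det C`. [cite: Breitung1994, Lemma 26 (2.102), p. 30] -/
theorem det_le_det_of_inner_le {A B : V →ₗ[ℝ] V} (hA : A.IsSymmetric) (hB : B.IsSymmetric) {lam : ℝ} (hlam : 0 < lam)
    (hcoer : ∀ y : V, lam * ‖y‖ ^ 2 ≤ ⟪A y, y⟫_ℝ) (hle : ∀ y : V, ⟪A y, y⟫_ℝ ≤ ⟪B y, y⟫_ℝ) :
    LinearMap.det A ≤ LinearMap.det B := by
  have hcoerB : ∀ y : V, lam * ‖y‖ ^ 2 ≤ ⟪B y, y⟫_ℝ := fun y => (hcoer y).trans (hle y)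
  have hGA := integral_exp_neg_mul_half_inner hA hlam hcoer (s := 1) one_pos
  have hGB := integral_exp_neg_mul_half_inner hB hlam hcoerB (s := 1) one_pos
  have hint : ∫ y : V, Real.exp (-(1 * ((1 / 2) * ⟪B y, y⟫_ℝ))) ≤ ∫ y : V, Real.exp (-(1 * ((1 / 2) * ⟪A y, y⟫_ℝ))) :=
    integral_mono (integrable_exp_neg_mul_half_inner hlam hcoerB one_pos)
      (integrable_exp_neg_mul_half_inner hlam hcoer one_pos) fun y => by
        dsimp only
        rw [Real.exp_le_exp]
        linarith [hle y]
  rw [hGA, hGB] at hint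
  have hdA : 0 < LinearMap.det A := det_pos_of_inner_pos hA (inner_pos_of_coercive hlam hcoer)
  have hdB : 0 < LinearMap.det B := det_pos_of_inner_pos hB (inner_pos_of_coercive hlam hcoerB)
  have hc : 0 < (2 * π / (1 : ℝ)) ^ ((finrank ℝ V : ℝ) / 2) := Real.rpow_pos_of_pos (by positivity) _
  rw [div_le_div_iff_of_pos_left hc (Real.sqrt_pos.2 hdB) (Real.sqrt_pos.2 hdA)] at hint
  exact (Real.sqrt_le_sqrt_iff hdB.le).1 hint

/-! ## §2 Two-sided comparison under a quadratic-form perturbation -/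

/-- ★★ **Lower comparison**: `B` symmetric and `λ`-coercive, `A` symmetric with `|⟪Ay,y⟫ − ⟪By,y⟫| ≤ δ‖y‖²`, `0 ≤ δ < λ`
⟹ `(1 − δ/λ)^m · det B ≤ det A`. [cite: Breitung1994, Lemma 26 (2.102), p. 30] -/
theorem pow_mul_det_le_det_of_inner_sub_le {A B : V →ₗ[ℝ] V} (hA : A.IsSymmetric) (hB : B.IsSymmetric)
    {lam δ : ℝ} (hlam : 0 < lam) (hδ0 : 0 ≤ δ) (hδ : δ < lam)
    (hcoerB : ∀ y : V, lam * ‖y‖ ^ 2 ≤ ⟪B y, y⟫_ℝ)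
    (hpert : ∀ y : V, |⟪A y, y⟫_ℝ - ⟪B y, y⟫_ℝ| ≤ δ * ‖y‖ ^ 2) :
    (1 - δ / lam) ^ finrank ℝ V * LinearMap.det B ≤ LinearMap.det A := by
  set s : ℝ := 1 - δ / lam with hs
  have hs_pos : 0 < s := by
    rw [hs, sub_pos, div_lt_one hlam]; exact hδ
  have hsB : (s • B).IsSymmetric := hB.smul (by simp)
  -- `s•B` is `(sλ)`-coercive and dominated by `A`
  have hcoer_sB : ∀ y : V, (s * lam) * ‖y‖ ^ 2 ≤ ⟪(s • B) y, y⟫_ℝ := fun y => by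
    rw [LinearMap.smul_apply, real_inner_smul_left, mul_assoc]
    exact mul_le_mul_of_nonneg_left (hcoerB y) hs_pos.le
  have hle : ∀ y : V, ⟪(s • B) y, y⟫_ℝ ≤ ⟪A y, y⟫_ℝ := fun y => by
    rw [LinearMap.smul_apply, real_inner_smul_left, hs]
    have h1 := hpert y
    have h2 := hcoerB y
    rw [abs_le] at h1
    -- `δ‖y‖² ≤ (δ/λ)⟪By,y⟫`
    have h3 : δ * ‖y‖ ^ 2 ≤ δ / lam * ⟪B y, y⟫_ℝ := by
      rw [div_mul_eq_mul_div, le_div_iff₀ hlam]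
      calc δ * ‖y‖ ^ 2 * lam = δ * (lam * ‖y‖ ^ 2) := by ring
        _ ≤ δ * ⟪B y, y⟫_ℝ := mul_le_mul_of_nonneg_left h2 hδ0
    nlinarith
  have h := det_le_det_of_inner_le hsB hA (mul_pos hs_pos hlam) hcoer_sB hle
  rwa [LinearMap.det_smul] at h

/-- ★★ **Upper comparison**: `B` symmetric and `λ`-coercive, `A` symmetric with `|⟪Ay,y⟫ − ⟪By,y⟫| ≤ δ‖y‖²`, `0 ≤ δ < λ`
⟹ `det A ≤ (1 + δ/λ)^m · det B`. [cite: Breitung1994, Lemma 26 (2.102), p. 30] -/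
theorem det_le_pow_mul_det_of_inner_sub_le {A B : V →ₗ[ℝ] V} (hA : A.IsSymmetric) (hB : B.IsSymmetric)
    {lam δ : ℝ} (hlam : 0 < lam) (hδ0 : 0 ≤ δ) (hδ : δ < lam)
    (hcoerB : ∀ y : V, lam * ‖y‖ ^ 2 ≤ ⟪B y, y⟫_ℝ)
    (hpert : ∀ y : V, |⟪A y, y⟫_ℝ - ⟪B y, y⟫_ℝ| ≤ δ * ‖y‖ ^ 2) :
    LinearMap.det A ≤ (1 + δ / lam) ^ finrank ℝ V * LinearMap.det B := by
  set s : ℝ := 1 + δ / lam with hs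
  have hs_pos : 0 < s := by rw [hs]; positivity
  have hsB : (s • B).IsSymmetric := hB.smul (by simp)
  -- `A` is `(λ − δ)`-coercive and dominated by `s•B`
  have hcoerA : ∀ y : V, (lam - δ) * ‖y‖ ^ 2 ≤ ⟪A y, y⟫_ℝ := fun y => by
    have h1 := hpert y
    have h2 := hcoerB y
    rw [abs_le] at h1
    nlinarith
  have hle : ∀ y : V, ⟪A y, y⟫_ℝ ≤ ⟪(s • B) y, y⟫_ℝ := fun y => by
    rw [LinearMap.smul_apply, real_inner_smul_left, hs]
    have h1 := hpert y
    have h2 := hcoerB y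
    rw [abs_le] at h1
    have h3 : δ * ‖y‖ ^ 2 ≤ δ / lam * ⟪B y, y⟫_ℝ := by
      rw [div_mul_eq_mul_div, le_div_iff₀ hlam]
      calc δ * ‖y‖ ^ 2 * lam = δ * (lam * ‖y‖ ^ 2) := by ring
        _ ≤ δ * ⟪B y, y⟫_ℝ := mul_le_mul_of_nonneg_left h2 hδ0
    nlinarith
  have h := det_le_det_of_inner_le hA hsB (by linarith : 0 < lam - δ) hcoerA hle
  rwa [LinearMap.det_smul] at h

/-! ## §3 The logarithmic form -/

/-- ★★ **`|log det A − log det B| ≤ 2m·δ/λ`** for symmetric `A`, `B` with `B` `λ`-coercive and `|⟪Ay,y⟫ − ⟪By,y⟫| ≤ δ‖y‖²`,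
`0 ≤ δ ≤ λ/2` (`m = finrank`): the one-loop weight `(det A)^{−1/2}` is Lipschitz in the quadratic form with the dimension-linear
constant `m/λ`. [cite: Breitung1994, Lemma 26 (2.102), p. 30] -/
theorem abs_log_det_sub_log_det_le {A B : V →ₗ[ℝ] V} (hA : A.IsSymmetric) (hB : B.IsSymmetric)
    {lam δ : ℝ} (hlam : 0 < lam) (hδ0 : 0 ≤ δ) (hδ : δ ≤ lam / 2)
    (hcoerB : ∀ y : V, lam * ‖y‖ ^ 2 ≤ ⟪B y, y⟫_ℝ)
    (hpert : ∀ y : V, |⟪A y, y⟫_ℝ - ⟪B y, y⟫_ℝ| ≤ δ * ‖y‖ ^ 2) :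
    |Real.log (LinearMap.det A) - Real.log (LinearMap.det B)| ≤ 2 * (finrank ℝ V : ℝ) * δ / lam := by
  have hδlt : δ < lam := by linarith
  set t : ℝ := δ / lam with ht
  have ht0 : 0 ≤ t := by rw [ht]; positivity
  have ht2 : t ≤ 1 / 2 := by rw [ht, div_le_iff₀ hlam]; linarith
  have hlo := pow_mul_det_le_det_of_inner_sub_le hA hB hlam hδ0 hδlt hcoerB hpert
  have hhi := det_le_pow_mul_det_of_inner_sub_le hA hB hlam hδ0 hδlt hcoerB hpert
  have hdB : 0 < LinearMap.det B := det_pos_of_inner_pos hB (inner_pos_of_coercive hlam hcoerB)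
  have h1t : 0 < 1 - t := by linarith
  have h1t' : 0 < 1 + t := by linarith
  have hdA : 0 < LinearMap.det A := lt_of_lt_of_le (mul_pos (pow_pos h1t _) hdB) hlo
  set m : ℕ := finrank ℝ V with hm
  have hm0 : (0 : ℝ) ≤ (m : ℝ) := Nat.cast_nonneg _
  -- logarithms of the two comparisons
  have e1 : (m : ℝ) * Real.log (1 - t) + Real.log (LinearMap.det B) ≤ Real.log (LinearMap.det A) := by
    have h := Real.log_le_log (mul_pos (pow_pos h1t _) hdB) hlo
    rwa [Real.log_mul (pow_pos h1t _).ne' hdB.ne', Real.log_pow] at h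
  have e2 : Real.log (LinearMap.det A) ≤ (m : ℝ) * Real.log (1 + t) + Real.log (LinearMap.det B) := by
    have h := Real.log_le_log hdA hhi
    rwa [Real.log_mul (pow_pos h1t' _).ne' hdB.ne', Real.log_pow] at h
  -- `log(1+t) ≤ t` and `log(1−t) ≥ −t/(1−t) ≥ −2t`
  have hup : Real.log (1 + t) ≤ t := by
    have := Real.log_le_sub_one_of_pos h1t'
    linarith
  have hlow : -(2 * t) ≤ Real.log (1 - t) := by
    have h1 := Real.one_sub_inv_le_log_of_pos h1t
    have h2 : (1 - t)⁻¹ ≤ 1 + 2 * t := by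
      rw [inv_le_iff_one_le_mul₀ h1t]
      nlinarith
    linarith
  have hgoal : 2 * (m : ℝ) * δ / lam = (m : ℝ) * (2 * t) := by rw [ht]; ring
  rw [hgoal, abs_le]
  constructor
  · have h := mul_le_mul_of_nonneg_left hlow hm0
    linarith
  · have h := mul_le_mul_of_nonneg_left hup hm0
    nlinarith

/-! ### (appended 2026-08-31, same seat) The determinant factor of the Gaussian main term under a form perturbation — (T2) by name

The LEAD plan's (T2): `det A_F(P̃)^{−1/2} ≤ e^{1/2}·det A_F(p₀)^{−1/2}` whenever the two follower Hessian forms differ by `≤ δ‖y‖²` with `2mδ ≤ λ`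
(✓`abs_followerHessianForm_sub_le` supplies `δ = M₃·max(1, M₂∕λ′)·‖ι p − ι p′‖`). -/

/-- ★★ **(T2) by name — the `√det` factors of two nearby forms are comparable**: `A`, `B` symmetric, `B` `λ`-coercive, `|⟪Ay,y⟫ − ⟪By,y⟫| ≤ δ‖y‖²`, `0 ≤ δ ≤ λ∕2`
⟹ `√det B ≤ e^{mδ∕λ}·√det A` and `√det A ≤ e^{mδ∕λ}·√det B` (`m = dim V`). [folklore] -/
theorem sqrt_det_le_exp_mul_sqrt_det {A B : V →ₗ[ℝ] V} (hA : A.IsSymmetric) (hB : B.IsSymmetric)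
    {lam δ : ℝ} (hlam : 0 < lam) (hδ0 : 0 ≤ δ) (hδ : δ ≤ lam / 2)
    (hcoerB : ∀ y : V, lam * ‖y‖ ^ 2 ≤ ⟪B y, y⟫_ℝ)
    (hpert : ∀ y : V, |⟪A y, y⟫_ℝ - ⟪B y, y⟫_ℝ| ≤ δ * ‖y‖ ^ 2) :
    Real.sqrt (LinearMap.det B) ≤ Real.exp ((finrank ℝ V : ℝ) * δ / lam) * Real.sqrt (LinearMap.det A) ∧
    Real.sqrt (LinearMap.det A) ≤ Real.exp ((finrank ℝ V : ℝ) * δ / lam) * Real.sqrt (LinearMap.det B) := by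
  have hlog := abs_log_det_sub_log_det_le hA hB hlam hδ0 hδ hcoerB hpert
  have hδlt : δ < lam := by linarith
  have hdB : 0 < LinearMap.det B := det_pos_of_inner_pos hB (inner_pos_of_coercive hlam hcoerB)
  have hlo := pow_mul_det_le_det_of_inner_sub_le hA hB hlam hδ0 hδlt hcoerB hpert
  have h1t : 0 < 1 - δ / lam := by rw [sub_pos, div_lt_one hlam]; exact hδlt
  have hdA : 0 < LinearMap.det A := lt_of_lt_of_le (mul_pos (pow_pos h1t _) hdB) hlo
  set c : ℝ := (finrank ℝ V : ℝ) * δ / lam with hc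
  have hc2 : 2 * (finrank ℝ V : ℝ) * δ / lam = 2 * c := by rw [hc]; ring
  rw [hc2] at hlog
  obtain ⟨h1, h2⟩ := abs_le.1 hlog
  -- `det B ≤ e^{2c} det A` and `det A ≤ e^{2c} det B`
  have hsq : Real.sqrt (Real.exp (2 * c)) = Real.exp c := by
    rw [show Real.exp (2 * c) = Real.exp c ^ 2 by rw [← Real.exp_nat_mul]; ring_nf, Real.sqrt_sq (Real.exp_pos c).le]
  have key : ∀ {x y : ℝ}, 0 < x → 0 < y → Real.log x ≤ Real.log y + 2 * c → Real.sqrt x ≤ Real.exp c * Real.sqrt y := by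
    intro x y hx hy hle
    have hxy : x ≤ Real.exp (2 * c) * y := by
      have := Real.exp_le_exp.2 hle
      rwa [Real.exp_log hx, Real.exp_add, Real.exp_log hy, mul_comm] at this
    calc Real.sqrt x ≤ Real.sqrt (Real.exp (2 * c) * y) := Real.sqrt_le_sqrt hxy
      _ = Real.sqrt (Real.exp (2 * c)) * Real.sqrt y := Real.sqrt_mul (Real.exp_pos _).le y
      _ = Real.exp c * Real.sqrt y := by rw [hsq]
  exact ⟨key hdB hdA (by linarith), key hdA hdB (by linarith)⟩

/-- ★ **Main-term form**: for a weight `w ≥ 0`, `w∕√det A ≤ e^{mδ∕λ}·w∕√det B` and `w∕√det B ≤ e^{mδ∕λ}·w∕√det A` — the integrands `w₀ p∕√det(A p)` of the fibred main term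
compared between a tip base point and a nearby bulk valley point. [folklore] -/
theorem div_sqrt_det_le_exp_mul {A B : V →ₗ[ℝ] V} (hA : A.IsSymmetric) (hB : B.IsSymmetric)
    {lam δ : ℝ} (hlam : 0 < lam) (hδ0 : 0 ≤ δ) (hδ : δ ≤ lam / 2)
    (hcoerB : ∀ y : V, lam * ‖y‖ ^ 2 ≤ ⟪B y, y⟫_ℝ)
    (hpert : ∀ y : V, |⟪A y, y⟫_ℝ - ⟪B y, y⟫_ℝ| ≤ δ * ‖y‖ ^ 2) {w : ℝ} (hw : 0 ≤ w) :
    w / Real.sqrt (LinearMap.det A) ≤ Real.exp ((finrank ℝ V : ℝ) * δ / lam) * (w / Real.sqrt (LinearMap.det B)) ∧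
    w / Real.sqrt (LinearMap.det B) ≤ Real.exp ((finrank ℝ V : ℝ) * δ / lam) * (w / Real.sqrt (LinearMap.det A)) := by
  obtain ⟨hBA, hAB⟩ := sqrt_det_le_exp_mul_sqrt_det hA hB hlam hδ0 hδ hcoerB hpert
  have hδlt : δ < lam := by linarith
  have hdB : 0 < LinearMap.det B := det_pos_of_inner_pos hB (inner_pos_of_coercive hlam hcoerB)
  have hlo := pow_mul_det_le_det_of_inner_sub_le hA hB hlam hδ0 hδlt hcoerB hpert
  have h1t : 0 < 1 - δ / lam := by rw [sub_pos, div_lt_one hlam]; exact hδlt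
  have hdA : 0 < LinearMap.det A := lt_of_lt_of_le (mul_pos (pow_pos h1t _) hdB) hlo
  have hsA : 0 < Real.sqrt (LinearMap.det A) := Real.sqrt_pos.2 hdA
  have hsB : 0 < Real.sqrt (LinearMap.det B) := Real.sqrt_pos.2 hdB
  set E : ℝ := Real.exp ((finrank ℝ V : ℝ) * δ / lam) with hE
  have hE0 : 0 < E := Real.exp_pos _
  constructor
  · -- `w/√A ≤ E w/√B ⟸ √B ≤ E √A`
    rw [← mul_div_assoc, div_le_div_iff₀ hsA hsB]
    calc w * Real.sqrt (LinearMap.det B) ≤ w * (E * Real.sqrt (LinearMap.det A)) := mul_le_mul_of_nonneg_left hBA hw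
      _ = E * w * Real.sqrt (LinearMap.det A) := by ring
  · rw [← mul_div_assoc, div_le_div_iff₀ hsB hsA]
    calc w * Real.sqrt (LinearMap.det A) ≤ w * (E * Real.sqrt (LinearMap.det B)) := mul_le_mul_of_nonneg_left hAB hw
      _ = E * w * Real.sqrt (LinearMap.det B) := by ring

end Summit.QuantumFields.YangMills.Theorems.QuantitativeLaplace

end
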